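import Literature.NumberTheory.GaloisRepresentations.ProjectiveTypeSolvable
import HarnessLib

/-!
# The local image at a good dihedral prime: irreducibility, large projective order, and
# Frobenius as a reflection (Khare–Wintenberger (I), Def. 2.1 and Lemma 6.3 (i))

Topic `Literature/NumberTheory/GaloisRepresentations`; theorems only (no definitions, no named
facts).  Khare–Wintenberger, *Serre's modularity conjecture (I)*, Invent. Math. 178 (2009):
a prime `q` is a *good dihedral prime* for `ρ̄ : G_ℚ → GL₂(𝔽̄_p)` (Def. 2.1) when `ρ̄|I_q` is
`ψ ⊕ ψ^q` for a character `ψ` of `I_q` of order a power `t^a` of an odd prime `t ∣ q + 1`,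
`t > max(…, 5, p)` (and `q ≡ 1` modulo `8` and modulo the small primes).  The proof of
Lemma 6.3 (i) ("the image of `ρ̄` is not solvable") begins:

> As `t` does not divide `q − 1`, `ρ̄|D_q` is irreducible, and hence so is `ρ̄`.  As `t > 5`,
> we see that the projective image cannot be `A₅`.  We see that if the image of `ρ̄` is
> solvable, as `t > 5`, then by Dickson's theorem the projective image of `ρ̄` is dihedral. …
> Suppose `ρ̄` is induced from `G_K` with `K` a quadratic extension of `ℚ`. … the prime `q`
> either splits in `K` or is ramified in `K`: both possibilities lead to a contradiction.

This file proves the **group theory** of these sentences, for an abstract group `Γ` (think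
`Γ = G_ℚ ⊇ D_q`), a homomorphism `ρ : Γ →* GL₂(k)` over a field `k`, an element `x₀ ∈ Γ` (a
generator of `ρ̄(I_q)`) with `ρ(x₀) = diag(c, c^q)` and an element `φ ∈ Γ` (a Frobenius at `q`)
with `ρ(φ x₀ φ⁻¹) = ρ(x₀)^q` (the tame relation), where the order of `c = ψ(x₀)` is prime to
`q (q − 1)` (for `t ∣ q + 1` odd: `GoodDihedralLocal.not_dvd_of_prime_dvd_succ`):

* `GoodDihedralLocal.not_hasCommonEigenvector` — **`ρ` has no common eigenvector** (so `ρ̄|D_q`,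
  and a fortiori `ρ̄`, is irreducible: `isIrreducible_of_not_hasCommonEigenvector`, proved here
  characteristic-free): a common eigenline would be `k e₀` or `k e₁` (`c ≠ c^q`), and comparing
  `ρ(φ x₀ φ⁻¹) = ρ(x₀)^q` on it gives `c = c^q` or `c^q = c^{q²}`.
* `GoodDihedralLocal.orderOf_mk_eq` — the class of `ρ(x₀)` in `PGL₂(k)` has order
  `ord(c^{q-1}) = ord(c)` (`GL2.orderOf_mk_of_eq_diagonal`: the class of `diag(d₀, d₁)` has the
  order of `d₁/d₀`), an element of order `t^a > 5` in the projective image; hence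
  `not_isIcosahedralType_of_lt_orderOf` (the elements of `𝔄₅` have order `≤ 5`) and, for
  solvable image, dihedral type by `isDihedralType_of_lt_orderOf_anyChar` of
  `ProjectiveTypeSolvableAnyChar` (Dickson; not imported here).
* `GoodDihedralLocal.eq_r_and_eq_sr` — **in any dihedral model `\bar ρ(Γ) ≃* D_m`, `x₀` is a
  rotation and `φ` a reflection**: `\bar ρ(x₀)` has order `> 2` (reflections are involutions),
  and a rotation `\bar ρ(φ)` would commute with it, whereas `\bar ρ(φ) \bar ρ(x₀) \bar ρ(φ)⁻¹ =
  \bar ρ(x₀)^q ≠ \bar ρ(x₀)`.  With `K` the quadratic field cut out by the rotations this says: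
  `I_q ⊆ G_K` and `Frob_q ∉ G_K`, i.e. `q` is inert in `K` — which Def. 2.1 (ii) forbids
  (`Automorphic/GoodDihedralPrimeSplitting`: `q` splits in every quadratic field unramified
  outside primes `s` with `q ≡ 1 (mod s)`).  This is the content of "both possibilities lead to
  a contradiction".

## References

* [KhareWintenberger2009] C. Khare, J.-P. Wintenberger, *Serre's modularity conjecture (I)*,
  Invent. Math. 178 (2009), 485–504: Def. 2.1; §6, Lemma 6.3 (i) and its proof.
-/

open Matrix Subgroup
open scoped MatrixGroups

namespace Literature.NumberTheory.GaloisRepresentations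

/-! ### Irreducibility from the absence of a common eigenvector (any characteristic) -/

section Irreducible

variable {G : Type*} [Group G] {k : Type*} [Field k]

/-- **No common eigenvector ⇒ irreducible** for `ρ : G →* GL₂(k)` over any field: a proper
non-trivial subrepresentation of `k²` is a line, i.e. a common eigenvector.  (Converse of
`not_hasCommonEigenvector_of_isIrreducible`; the argument of
`isIrreducible_of_not_isCyclicType` without its characteristic-`0` detour.) [folklore] -/
theorem isIrreducible_of_not_hasCommonEigenvector (ρ : G →* GL (Fin 2) k)
    (h : ¬ HasCommonEigenvector ρ) : (toStdRepresentation ρ).IsIrreducible := by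
  classical
  haveI : Nontrivial (Subrepresentation (toStdRepresentation ρ)) := by
    refine ⟨⟨⊥, ⊤, fun hbt => ?_⟩⟩
    have : (Pi.single 0 1 : Fin 2 → k) ∈ (⊥ : Subrepresentation (toStdRepresentation ρ)) := by
      rw [hbt]; trivial
    have h0 : (Pi.single 0 1 : Fin 2 → k) = 0 := this
    exact one_ne_zero (congrFun h0 0)
  refine ⟨fun W => ?_⟩
  by_contra! hW
  obtain ⟨hWb, hWt⟩ := hW
  apply h
  -- `W` is a line
  have hcoe : (W : Set (Fin 2 → k)) = (W.toSubmodule : Set (Fin 2 → k)) := rfl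
  have hne : W.toSubmodule ≠ ⊤ := fun htop => by
    apply hWt
    apply SetLike.coe_injective
    rw [hcoe, htop]
    rfl
  have hlt : Module.finrank k W.toSubmodule < 2 := by
    have h2 := Submodule.finrank_lt hne
    rwa [Module.finrank_fin_fun] at h2
  have hpos : 0 < Module.finrank k W.toSubmodule := by
    rw [Module.finrank_pos_iff_exists_ne_zero]
    by_contra! hz
    apply hWb
    apply SetLike.coe_injective
    rw [hcoe]
    have hb : W.toSubmodule = ⊥ := by
      rw [Submodule.eq_bot_iff]
      intro x hx
      exact congrArg Subtype.val (hz ⟨x, hx⟩)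
    rw [hb]
    rfl
  have h1 : Module.finrank k W.toSubmodule = 1 := by omega
  obtain ⟨w, hw⟩ := finrank_eq_one_iff'.mp h1
  refine ⟨(w : Fin 2 → k), fun h0 => hw.1 (Subtype.ext h0), fun g => ?_⟩
  have hmem : ((ρ g : GL (Fin 2) k) : Matrix (Fin 2) (Fin 2) k) *ᵥ (w : Fin 2 → k) ∈
      W.toSubmodule :=
    W.apply_mem_toSubmodule g w.2
  obtain ⟨a, ha⟩ := hw.2 ⟨_, hmem⟩
  exact ⟨a, by simpa using congrArg Subtype.val ha.symm⟩

/-- `ρ : G →* GL₂(k)` is irreducible iff `ρ(G)` has no common eigenvector. [folklore] -/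
theorem isIrreducible_iff_not_hasCommonEigenvector (ρ : G →* GL (Fin 2) k) :
    (toStdRepresentation ρ).IsIrreducible ↔ ¬ HasCommonEigenvector ρ :=
  ⟨not_hasCommonEigenvector_of_isIrreducible ρ, isIrreducible_of_not_hasCommonEigenvector ρ⟩

end Irreducible

/-! ### The order of a diagonal class in `PGL₂(k)`; orders in `𝔄₅` -/

namespace GL2

variable {k : Type*} [Field k]

open Matrix.ProjGenLinGroup in
/-- The class in `PGL₂(k)` of a diagonal `x = diag(d₀, d₁)` has the order of `d₁ / d₀ ∈ kˣ`
(`\bar x ^ n = 1 ⟺ d₀^n = d₁^n`). [folklore] -/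
theorem orderOf_mk_of_eq_diagonal {x : GL (Fin 2) k} {d : Fin 2 → k}
    (hx : (x : Matrix (Fin 2) (Fin 2) k) = diagonal d) :
    orderOf (mk x) = orderOf (d 1 / d 0) := by
  have hd0 : d 0 ≠ 0 := by
    intro h0
    apply det_ne_zero x
    rw [hx, det_diagonal, Fin.prod_univ_two, h0, zero_mul]
  rw [orderOf_eq_orderOf_iff]
  intro n
  rw [← map_pow, Matrix.ProjGenLinGroup.mk_eq_one, mem_center_iff, Units.val_pow_eq_pow_val, hx,
    diagonal_pow, div_pow, div_eq_one_iff_eq (pow_ne_zero n hd0)]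
  simp only [diagonal_apply_ne _ (by decide : (0 : Fin 2) ≠ 1),
    diagonal_apply_ne _ (by decide : (1 : Fin 2) ≠ 0), diagonal_apply_eq, Pi.pow_apply,
    true_and]
  exact eq_comm

end GL2

/-- The elements of `𝔄₅` have order at most `5` (`σ⁵ = 1`, `σ³ = 1` or `σ² = 1` for each of its
`60` elements). [folklore] -/
theorem orderOf_alternatingGroup_fin_five_le (σ : alternatingGroup (Fin 5)) : orderOf σ ≤ 5 := by
  have key : ∀ τ : alternatingGroup (Fin 5), τ ^ 5 = 1 ∨ τ ^ 3 = 1 ∨ τ ^ 2 = 1 := by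
    set_option maxRecDepth 8000 in decide
  rcases key σ with h | h | h
  · exact orderOf_le_of_pow_eq_one (by norm_num) h
  · exact (orderOf_le_of_pow_eq_one (by norm_num) h).trans (by norm_num)
  · exact (orderOf_le_of_pow_eq_one (by norm_num) h).trans (by norm_num)

section Icosahedral

variable {G : Type*} [Group G] {k : Type*} [Field k]

open Matrix.ProjGenLinGroup in
/-- **An element of projective order `> 5` excludes icosahedral type** ("As `t > 5`, we see that
the projective image cannot be `A₅`"). [cite: KhareWintenberger2009, §6, proof of Lemma 6.3 (i)] -/
theorem not_isIcosahedralType_of_lt_orderOf (ρ : G →* GL (Fin 2) k) {g : G}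
    (hg : 5 < orderOf (mk (ρ g))) : ¬ IsIcosahedralType ρ := by
  rintro ⟨e⟩
  set x : projectiveImage ρ := ⟨mk (ρ g), g, rfl⟩ with hx
  have hxord : orderOf x = orderOf (mk (ρ g)) := Subgroup.orderOf_mk _ _
  have h1 : orderOf (e x) = orderOf x := MulEquiv.orderOf_eq e x
  have h3 := orderOf_alternatingGroup_fin_five_le (e x)
  rw [h1, hxord] at h3
  omega

end Icosahedral

/-! ### The local image at a good dihedral prime -/

namespace GoodDihedralLocal

variable {Γ : Type*} [Group Γ] {k : Type*} [Field k]

/-- For an odd prime `t ∣ q + 1`: `t ∤ q - 1` and `t ∤ q` (`gcd(q+1, q-1) ∣ 2`,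
`gcd(q+1, q) = 1`). [cite: KhareWintenberger2009, Def. 2.1 (i)] -/
theorem not_dvd_of_prime_dvd_succ {t q : ℕ} (ht : t.Prime) (ht2 : t ≠ 2) (htq : t ∣ q + 1)
    (hq : 1 ≤ q) : ¬ t ∣ q - 1 ∧ ¬ t ∣ q := by
  constructor
  · intro h
    have h2 : t ∣ (q + 1) - (q - 1) := Nat.dvd_sub htq h
    rw [show q + 1 - (q - 1) = 2 by omega] at h2
    have := (Nat.prime_dvd_prime_iff_eq ht Nat.prime_two).mp h2
    exact ht2 this
  · intro h
    have h1 : t ∣ (q + 1) - q := Nat.dvd_sub htq h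
    rw [show q + 1 - q = 1 by omega] at h1
    exact ht.one_lt.ne' (Nat.dvd_one.mp h1)

/-- Hence a power `t^a` of such a `t` is prime to `q - 1` and to `q`: the coprimality
hypotheses below, for `ord(c) = t^a` as in Def. 2.1 (i). [cite: KhareWintenberger2009, Def. 2.1 (i)] -/
theorem coprime_pow_of_prime_dvd_succ {t q : ℕ} (ht : t.Prime) (ht2 : t ≠ 2) (htq : t ∣ q + 1)
    (hq : 1 ≤ q) (a : ℕ) : (t ^ a).Coprime (q - 1) ∧ (t ^ a).Coprime q := by
  obtain ⟨h1, h2⟩ := not_dvd_of_prime_dvd_succ ht ht2 htq hq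
  exact ⟨Nat.Coprime.pow_left a ((Nat.Prime.coprime_iff_not_dvd ht).mpr h1),
    Nat.Coprime.pow_left a ((Nat.Prime.coprime_iff_not_dvd ht).mpr h2)⟩

/-- If `ord(c)` is prime to `n` and `c ≠ 1` then `c ^ n ≠ 1`. [folklore] -/
theorem pow_ne_one_of_coprime {c : k} {n : ℕ} (hcop : (orderOf c).Coprime n) (hc : c ≠ 1) :
    c ^ n ≠ 1 := by
  intro h
  apply hc
  rw [← orderOf_eq_one_iff]
  exact hcop.eq_one_of_dvd (orderOf_dvd_iff_pow_eq_one.mpr h)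

open Matrix.ProjGenLinGroup in
/-- **`ρ̄|D_q` is irreducible** ("As `t` does not divide `q − 1`, `ρ̄|D_q` is irreducible, and
hence so is `ρ̄`"), group-theoretic form: if `ρ(x₀) = diag(c, c^q)`, `ρ(φ x₀ φ⁻¹) = ρ(x₀)^q`,
`c^{q-1} ≠ 1` and `c^{q(q-1)} ≠ 1`, then `ρ(Γ)` has no common eigenvector.  For a common
eigenvector `v` is `e₀` or `e₁` up to scalars (`c ≠ c^q`), with `ρ(x₀) v = a v`,
`a ∈ {c, c^q}`; applying `ρ(φ x₀ φ⁻¹) = ρ(φ) ρ(x₀) ρ(φ)⁻¹` to `v` gives `a v` again, while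
`ρ(x₀)^q v ∈ {c^q v, c^{q²} v}`: so `c = c^q` or `c^q = c^{q²}`.
[cite: KhareWintenberger2009, §6, proof of Lemma 6.3 (i)] -/
theorem not_hasCommonEigenvector (ρ : Γ →* GL (Fin 2) k) {x₀ φ : Γ} {c : k} {q : ℕ}
    (hq : 1 ≤ q)
    (h0 : ((ρ x₀ : GL (Fin 2) k) : Matrix (Fin 2) (Fin 2) k) = diagonal ![c, c ^ q])
    (hφ : ρ (φ * x₀ * φ⁻¹) = ρ x₀ ^ q) (hc1 : c ^ (q - 1) ≠ 1) (hc2 : c ^ (q * (q - 1)) ≠ 1) :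
    ¬ HasCommonEigenvector ρ := by
  rintro ⟨v, hv, hev⟩
  have hc0 : c ≠ 0 := by
    intro h
    apply GL2.det_ne_zero (ρ x₀)
    rw [h0, det_diagonal, Fin.prod_univ_two, h]
    simp
  -- the eigenvalue `a` of `ρ x₀` on `v` and `b` of `ρ φ`
  obtain ⟨a, ha⟩ := hev x₀
  obtain ⟨b, hb⟩ := hev φ
  set P : Matrix (Fin 2) (Fin 2) k := ((ρ φ : GL (Fin 2) k) : Matrix (Fin 2) (Fin 2) k) with hP
  set Pi : Matrix (Fin 2) (Fin 2) k := (((ρ φ)⁻¹ : GL (Fin 2) k) : Matrix (Fin 2) (Fin 2) k)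
    with hPi
  have hPiP : Pi * P = 1 := by
    rw [hPi, hP, ← Matrix.GeneralLinearGroup.coe_mul, inv_mul_cancel,
      Matrix.GeneralLinearGroup.coe_one]
  have hb0 : b ≠ 0 := by
    intro hb0
    apply hv
    rw [hb0, zero_smul] at hb
    calc v = Pi *ᵥ (P *ᵥ v) := by rw [mulVec_mulVec, hPiP, one_mulVec]
      _ = 0 := by rw [hb, mulVec_zero]
  have hPiv : Pi *ᵥ v = b⁻¹ • v := by
    have h1 : Pi *ᵥ (P *ᵥ v) = v := by rw [mulVec_mulVec, hPiP, one_mulVec]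
    rw [hb, mulVec_smul] at h1
    calc Pi *ᵥ v = b⁻¹ • (b • (Pi *ᵥ v)) := by rw [smul_smul, inv_mul_cancel₀ hb0, one_smul]
      _ = b⁻¹ • v := by rw [h1]
  -- `ρ(φ x₀ φ⁻¹) v = a v`
  have hconj : ((ρ (φ * x₀ * φ⁻¹) : GL (Fin 2) k) : Matrix (Fin 2) (Fin 2) k) *ᵥ v = a • v := by
    have hmat : ((ρ (φ * x₀ * φ⁻¹) : GL (Fin 2) k) : Matrix (Fin 2) (Fin 2) k) =
        P * ((ρ x₀ : GL (Fin 2) k) : Matrix (Fin 2) (Fin 2) k) * Pi := by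
      rw [map_mul, map_mul, map_inv, Matrix.GeneralLinearGroup.coe_mul,
        Matrix.GeneralLinearGroup.coe_mul]
    rw [hmat, ← mulVec_mulVec, ← mulVec_mulVec, hPiv, mulVec_smul, ha, mulVec_smul, mulVec_smul,
      hb, smul_smul, smul_smul, show b⁻¹ * a * b = a by field_simp]
  -- `ρ(x₀)^q v = diag(c^q, c^{q²}) v`
  have hpow : ((ρ (φ * x₀ * φ⁻¹) : GL (Fin 2) k) : Matrix (Fin 2) (Fin 2) k) =
      diagonal ![c ^ q, (c ^ q) ^ q] := by
    rw [hφ, Units.val_pow_eq_pow_val, h0, diagonal_pow]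
    congr 1
    ext i
    fin_cases i <;> simp
  rw [hpow] at hconj
  rw [h0] at ha
  -- compare coordinates
  have e0 : c * v 0 = a * v 0 := by
    have := congr_fun ha 0; rwa [mulVec_diagonal] at this
  have e1 : c ^ q * v 1 = a * v 1 := by
    have := congr_fun ha 1; rwa [mulVec_diagonal] at this
  have f0 : c ^ q * v 0 = a * v 0 := by
    have := congr_fun hconj 0; rwa [mulVec_diagonal] at this
  have f1 : (c ^ q) ^ q * v 1 = a * v 1 := by
    have := congr_fun hconj 1; rwa [mulVec_diagonal] at this
  by_cases hv0 : v 0 = 0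
  · have hv1 : v 1 ≠ 0 := by
      intro hv1
      apply hv
      ext i
      fin_cases i
      · exact hv0
      · exact hv1
    have h1 : c ^ q = a := mul_right_cancel₀ hv1 e1
    have h2 : (c ^ q) ^ q = a := mul_right_cancel₀ hv1 f1
    apply hc2
    -- `c^{q²} = c^q` gives `c^{q(q-1)} = 1`
    have h3 : c ^ (q * (q - 1)) * c ^ q = 1 * c ^ q := by
      rw [one_mul, ← pow_add, show q * (q - 1) + q = q * q by
        rw [← Nat.mul_succ, Nat.succ_eq_add_one, Nat.sub_add_cancel hq], pow_mul, h2, h1]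
    exact mul_right_cancel₀ (pow_ne_zero q hc0) h3
  · have h1 : c = a := mul_right_cancel₀ hv0 e0
    have h2 : c ^ q = a := mul_right_cancel₀ hv0 f0
    apply hc1
    have h3 : c ^ (q - 1) * c = 1 * c := by
      rw [one_mul, ← pow_succ, Nat.sub_add_cancel hq, h2, h1]
    exact mul_right_cancel₀ hc0 h3

/-- The same under the coprimality hypotheses of Def. 2.1 (i) (`ord(c)` prime to `q - 1` and to
`q`, `c ≠ 1`). [cite: KhareWintenberger2009, §6, proof of Lemma 6.3 (i)] -/
theorem not_hasCommonEigenvector_of_coprime (ρ : Γ →* GL (Fin 2) k) {x₀ φ : Γ} {c : k} {q : ℕ}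
    (hq : 1 ≤ q)
    (h0 : ((ρ x₀ : GL (Fin 2) k) : Matrix (Fin 2) (Fin 2) k) = diagonal ![c, c ^ q])
    (hφ : ρ (φ * x₀ * φ⁻¹) = ρ x₀ ^ q) (hcop : (orderOf c).Coprime (q - 1))
    (hcopq : (orderOf c).Coprime q) (hc : c ≠ 1) : ¬ HasCommonEigenvector ρ :=
  not_hasCommonEigenvector ρ hq h0 hφ (pow_ne_one_of_coprime hcop hc)
    (pow_ne_one_of_coprime (Nat.Coprime.mul_right hcopq hcop) hc)

open Matrix.ProjGenLinGroup in
/-- **The projective order of `ρ(x₀) = diag(c, c^q)` is `ord(c^{q-1})`** (`c^q / c = c^{q-1}`), which is `ord(c)` when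
`ord(c)` is prime to `q - 1` (`Nat.Coprime.orderOf_pow`): an element of order `t^a` in the
projective image. [cite: KhareWintenberger2009, §6, proof of Lemma 6.3 (i)] -/
theorem orderOf_mk_eq (ρ : Γ →* GL (Fin 2) k) {x₀ : Γ} {c : k} {q : ℕ} (hq : 1 ≤ q)
    (h0 : ((ρ x₀ : GL (Fin 2) k) : Matrix (Fin 2) (Fin 2) k) = diagonal ![c, c ^ q]) :
    orderOf (mk (ρ x₀)) = orderOf (c ^ (q - 1)) := by
  have hc0 : c ≠ 0 := by
    intro h
    apply GL2.det_ne_zero (ρ x₀)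
    rw [h0, det_diagonal, Fin.prod_univ_two, h]
    simp
  rw [GL2.orderOf_mk_of_eq_diagonal h0]
  have : (![c, c ^ q] : Fin 2 → k) 1 / (![c, c ^ q] : Fin 2 → k) 0 = c ^ (q - 1) := by
    simp only [Matrix.cons_val_zero, Matrix.cons_val_one]
    rw [div_eq_iff hc0, ← pow_succ, Nat.sub_add_cancel hq]
  rw [this]

open Matrix.ProjGenLinGroup in
/-- Under the coprimality hypothesis the projective order of `ρ(x₀)` is `ord(c)` itself.
[cite: KhareWintenberger2009, §6, proof of Lemma 6.3 (i)] -/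
theorem orderOf_mk_eq_orderOf (ρ : Γ →* GL (Fin 2) k) {x₀ : Γ} {c : k} {q : ℕ} (hq : 1 ≤ q)
    (h0 : ((ρ x₀ : GL (Fin 2) k) : Matrix (Fin 2) (Fin 2) k) = diagonal ![c, c ^ q])
    (hcop : (orderOf c).Coprime (q - 1)) : orderOf (mk (ρ x₀)) = orderOf c := by
  rw [orderOf_mk_eq ρ hq h0, hcop.orderOf_pow]

open Matrix.ProjGenLinGroup in
/-- **Not icosahedral** ("As `t > 5`, we see that the projective image cannot be `A₅`"): if
`ord(c) > 5` is prime to `q - 1`. [cite: KhareWintenberger2009, §6, proof of Lemma 6.3 (i)] -/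
theorem not_isIcosahedralType (ρ : Γ →* GL (Fin 2) k) {x₀ : Γ} {c : k} {q : ℕ} (hq : 1 ≤ q)
    (h0 : ((ρ x₀ : GL (Fin 2) k) : Matrix (Fin 2) (Fin 2) k) = diagonal ![c, c ^ q])
    (hcop : (orderOf c).Coprime (q - 1)) (h5 : 5 < orderOf c) : ¬ IsIcosahedralType ρ :=
  not_isIcosahedralType_of_lt_orderOf ρ (g := x₀) (by rwa [orderOf_mk_eq_orderOf ρ hq h0 hcop])

open Matrix.ProjGenLinGroup DihedralGroup in
/-- **In a dihedral model of the projective image, `x₀` is a rotation and `φ` a reflection.**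
Let `e : \bar ρ(Γ) ≃* D_m`.  If `ρ(x₀) = diag(c, c^q)`, `ρ(φ x₀ φ⁻¹) = ρ(x₀)^q`, `ord(c) > 2`
prime to `q - 1`, then `e(\bar ρ(x₀)) = r i` (it has order `ord(c) > 2`, and the `sr j` are
involutions) and `e(\bar ρ(φ)) = sr j` (a rotation would commute with `r i`, but
`\bar ρ(φ) \bar ρ(x₀) \bar ρ(φ)⁻¹ = \bar ρ(x₀)^q ≠ \bar ρ(x₀)` as `\bar ρ(x₀)^{q-1} ≠ 1`).  For
`ρ = ρ̄` induced from the quadratic field `K` (the field of the rotations): `I_q ⊆ G_K` and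
`Frob_q ∉ G_K`, i.e. `q` is unramified and does not split in `K` — the configuration excluded in
the proof of Lemma 6.3 (i). [cite: KhareWintenberger2009, §6, proof of Lemma 6.3 (i)] -/
theorem eq_r_and_eq_sr (ρ : Γ →* GL (Fin 2) k) {x₀ φ : Γ} {c : k} {q : ℕ} (hq : 1 ≤ q)
    (h0 : ((ρ x₀ : GL (Fin 2) k) : Matrix (Fin 2) (Fin 2) k) = diagonal ![c, c ^ q])
    (hφ : ρ (φ * x₀ * φ⁻¹) = ρ x₀ ^ q) (hcop : (orderOf c).Coprime (q - 1)) (h2 : 2 < orderOf c)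
    {m : ℕ} (e : projectiveImage ρ ≃* DihedralGroup m) :
    (∃ i : ZMod m, e ⟨mk (ρ x₀), x₀, rfl⟩ = r i) ∧ (∃ j : ZMod m, e ⟨mk (ρ φ), φ, rfl⟩ = sr j) := by
  set g : projectiveImage ρ := ⟨mk (ρ x₀), x₀, rfl⟩ with hg
  set f : projectiveImage ρ := ⟨mk (ρ φ), φ, rfl⟩ with hf
  have hgord : orderOf g = orderOf c :=
    (Subgroup.orderOf_mk _ _).trans (orderOf_mk_eq_orderOf ρ hq h0 hcop)
  -- `x₀ ↦` a rotation
  have hgi : ∃ i : ZMod m, e g = r i := by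
    cases he : e g with
    | r i => exact ⟨i, rfl⟩
    | sr i =>
      exfalso
      have h1 : orderOf (e g) = 2 := by rw [he]; exact orderOf_sr i
      rw [MulEquiv.orderOf_eq, hgord] at h1
      omega
  refine ⟨hgi, ?_⟩
  obtain ⟨i, hi⟩ := hgi
  -- the tame relation in the projective image: `f g f⁻¹ = g ^ q`
  have hrel : f * g * f⁻¹ = g ^ q := by
    apply Subtype.ext
    simp only [hf, hg, Subgroup.coe_mul, Subgroup.coe_inv, Subgroup.coe_pow]
    rw [← map_inv, ← map_mul, ← map_mul, ← map_inv ρ, ← map_mul ρ, ← map_mul ρ, hφ, map_pow]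
  cases he : e f with
  | sr j => exact ⟨j, rfl⟩
  | r j =>
    exfalso
    -- a rotation commutes with `e g = r i`, so `g ^ q = g`, `g ^ (q - 1) = 1`
    have hcomm : e f * e g = e g * e f := by
      rw [he, hi, r_mul_r, r_mul_r, add_comm]
    have hfg : f * g = g * f := e.injective (by rw [map_mul, map_mul, hcomm])
    have hgq : g ^ q = g := by rw [← hrel, hfg, mul_inv_cancel_right]
    have hg1 : g ^ (q - 1) = 1 := by
      have : g ^ (q - 1) * g = 1 * g := by rw [one_mul, ← pow_succ, Nat.sub_add_cancel hq, hgq]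
      exact mul_right_cancel this
    have hdvd : orderOf c ∣ q - 1 := by
      rw [← hgord]
      exact orderOf_dvd_of_pow_eq_one hg1
    have := hcop.eq_one_of_dvd hdvd
    omega

end GoodDihedralLocal

end Literature.NumberTheory.GaloisRepresentations
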